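import Summits.NavierStokesRegularity.OSWSelfSimilar.CertificateViscousSheetRSpectrum
import HarnessLib
/-!
# Viscous gCLM/OSW profile sheet on the LINE (zone Z3, SHEET-ℝ), case Z3-SR-SPEC — IMPLEMENTATION 2 (impl-2) literals: the linearised
# spectrum certificate at `(a, c_l, ε) = (1/5, 1/2, 1)` in a SECOND, code-disjoint arithmetic; kernel-checked inequalities only
HONEST FRAMING (cell ns-blowup GROUP B «PROFILE SEARCH», human rulings D-0035/D-0074/D-0081; PROFILE-SPEC v1.3 case Z3-SR-SPEC; profile-lead
RULINGS (gq)(5) «F5(b)-SPEC» and (gz)(1) «S2-impl2», pre-lettered verdicts): **1-D MODEL (viscous gCLM/OSW on `ℝ` at the NS-type similarity exponent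
`c_l = 1/2`), computer-assisted; not Euler/NS; «violates: none — MODEL»; census hook `Literature.Analysis.FluidPDE.effectiveViscosity_half`.**
Nothing here is a statement about Navier–Stokes. This file is the implementation-2 COMPANION of `CertificateViscousSheetRSpectrum` (implementation 1,
seat ns-blowup-profile-cert-1): the same object (the pencil `σ ↦ DG(Ω*) + σJ` on `E` = odd `H¹_w`, `w = 64 + ξ²`, the rank-one–lifted operator
`A_F = DG(Ω̄) + F`, `Fδ = θ⟨h, wδ⟩Jh`, `θ = 4`, `h` = the 12 frame-mode dyadics of record, and its Evans function `E(σ) = 1 − θ⟨h, w(A_F + σJ)⁻¹Jh⟩`),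
the same registered constants `γ, γ′, c₁, c₂, R₀c, Δ` (imported), and NEW literals printed by implementation 2.
IMPLEMENTATION 2 (seat ns-blowup-profile-cert-2 g6/g7): numpy float64 / x86-extended midpoint–radius arithmetic with a-priori Higham `γ_n` bounds + CPython exact
rationals; NO Arb / MPFR. (S1) kit j269024 (`s1gram_impl2.json` sha16 `3ff893f7b20ff895`): the Gram certificate matrix of §6.5 of the impl-1 runbook re-assembled in
longdouble mid-rad from the printed primaries, `λ_min` by Cholesky residual + Weyl. (S2) kit j270205 (`s2_impl2.json` sha16 `94f123d366e47d6e`; code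
`HOME/profile/cert/impl2/specS2/`, `s2_impl2.py` `430df1918478e87d`): NOTHING read from implementation 1's staged sets — the adjoint operator `B_λ† − P†` tabulated
in the (1+cos)-factored sine frame of implementation 2, the float Galerkin matrix read off that table, the ten resolvent solves per contour point, the residual
enclosures, the error recursion `e_j`, the Taylor data `k_j`, the step radii, the argument increments (rational argument-halving `atan` + `π` bracket) and the
winding balls all re-derived; the FAR FIELD in a different, MIXED order-2 form
`|k(σ)| ≤ B₁/|σ| + B₂/|σ|²`, `B₁ ≥ θ‖h‖²_w + θ‖h‖_w S₁/c_w`, `B₂ ≥ θ|⟨h, g₁⟩_w| + θ(‖g₁ᵀ‖_w + S₁ᵀ)‖g₁‖_w/c_w` (`g₁`/`g₁ᵀ` the finite forward/adjoint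
images of `h`, `S₁`/`S₁ᵀ` their series tails; from `(T+σ)⁻¹h = h/σ − (T+σ)⁻¹Th/σ` used once on each side), giving the SMALLER certified radius `R₀ = 11.406`
(literal `R0B = 11.41`, UP) inside the same arc `R₀c = 12.7`. RESULT: the 23-point segment chain of record (final list `bb57fbdceffbb828`, no insertion needed) is
closed by implementation 2's own step radii (`min ρ = 0.28355 > 0.2128` = the first gap), `min|E| ≥ 0.45301`, `E(−γ′) ∈ [−0.45301301, −0.45301289]` real `< 0`,
`E(R₀c) ∈ [0.8023369702, 0.8023369704]` real `> 0`, winding `W ∈ [−1.00000096, −0.99999904]` (`Ω̄`), `W* ∈ [−1.0964, −0.9054]` (`Ω*`, Δ-inflated) ⇒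
`W = W* = −1`: EXACTLY ONE zero of `E*` in `{Re σ ≥ −γ′, |σ| ≤ R₀}` — in agreement with implementation 1 (whose `E` balls it reproduces to `1.2e-12` at all 27 points).
WORD OF RECORD after this file (pre-lettered (gq)(5)/(gz)(1), final on the profile-refuter's K-reads): «Z3-SR-SPEC … S1 AND S2 in TWO ARITHMETICS».
**What is NOT kernel-checked:** exactly the list of `CertificateViscousSheetRSpectrum` (items (i) the arithmetic of the programs — here implementation 2's mid-rad
layer and its series-tail bookkeeping — and (ii) the paper chain (P1)–(P8)); KERNEL-checked: the inequalities below on the printed literals, and the AGREEMENT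
facts between the two implementations' literals (both winding balls contain `−1` and no other integer; they intersect; `R0B ≤ R0`).
-/

namespace Summit.NavierStokesRegularity.OSWSelfSimilar
namespace CertificateViscousSheetRSpectrumB

open CertificateViscousSheetRSpectrum (theta gamma gammaP c1 c2 cw Delta cE cEstar R0 R0c W nZeros firstGap epsFree normS dGram
  WloBar WhiBar WloStar WhiStar cw_eq cE_eq)

/-! ### S1 — implementation 2 (F5(b)-SPEC, kit j269024) -/
/-- Certified lower bound (DOWN) of `λ_min(D(𝒢̂ − 𝒢̂S𝒢̂ − d′𝒢̂SᵀS𝒢̂)D)` in implementation 2's arithmetic (`2.24642351e-5`; implementation 1: `2.2462639e-5`). [folklore] -/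
def lamCertB : ℚ := (224642 : ℚ) / 10000000000
/-- Implementation 2's ε-budget (UP): `ε_τ + ε_drop + ε_tailM ≤ 1.6383e-5`, printed digit-identical to implementation 1's. [folklore] -/
def epsSumB : ℚ := (16383 : ℚ) / 1000000000

/-- THE S1 VERDICT INEQUALITY in implementation 2: the certified matrix is positive definite. [folklore] -/
theorem lamCertB_pos : 0 < lamCertB := by norm_num [lamCertB]
/-- Implementation 2's dropped-functional budget also fits into the free slack `ε_free` of the row of record. [folklore] -/
theorem epsSumB_le_epsFree : epsSumB ≤ epsFree := by
  norm_num [epsSumB, epsFree, CertificateViscousSheetRSpectrum.epsN, CertificateViscousSheetRSpectrum.epsBar,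
    CertificateViscousSheetRSpectrum.Dcons, CertificateViscousSheetRSpectrum.N]

/-! ### S2 — far field, implementation 2 (MIXED order-2 form; literals of `far.json`, kit j270205) -/
/-- `‖h‖²_w` (UP) as printed by implementation 2 (`0.718727123386924 ± 1.5e-15`; digit-identical to implementation 1). [folklore] -/
def hw2B : ℚ := (71872713 : ℚ) / 100000000
/-- `B₁ ≥ θ‖h‖²_w + θ‖h‖_w·S₁/c_w` (UP; `S₁ ≤ 5.76e-7` in `w`-norm). [folklore] -/
def B1 : ℚ := (287493 : ℚ) / 100000
/-- `B₂ ≥ θ|⟨h, g₁⟩_w| + θ(‖g₁ᵀ‖_w + S₁ᵀ)‖g₁‖_w/c_w` (UP; `⟨h,g₁⟩ = 1.3247309`, `‖g₁‖_w ≤ 1.6046746`, `‖g₁ᵀ‖_w ≤ 1.7105472`). [folklore] -/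
def B2 : ℚ := (967947 : ℚ) / 10000
/-- `pert ≥ sup|k*(σ) − k(σ)| = θΔ(2‖h‖_w/c_E)(2‖h‖_w/c_E*)` on `Re σ ≥ −γ′` (UP literal; implementation 2 prints `3.7450054e-3`). [folklore] -/
def pertB : ℚ := (3746 : ℚ) / 1000000
/-- Far-field radius literal of implementation 2: `R0B = 11.41` (UP of the certified `5703/500 = 11.406`). [folklore] -/
def R0B : ℚ := (1141 : ℚ) / 100

/-- `pertB` dominates the formula `16θΔ‖h‖²_w/(c_E·c_E*)` on implementation 2's `‖h‖²_w`. [folklore] -/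
theorem pertB_ge : theta * Delta * (4 * hw2B) / (cE * cEstar) ≤ pertB := by
  rw [cE_eq.1, cE_eq.2]
  norm_num [theta, Delta, CertificateViscousSheetR.Llip, CertificateViscousSheetR.rEsharp2, hw2B, pertB]
/-- FAR FIELD at `R0B` (mixed form): `B₁/R0B + B₂/R0B² + pert < 1`, so `|k|, |k*| < 1` for `|σ| ≥ R0B`, `Re σ ≥ −γ′` (decreasing in `|σ|`). [folklore] -/
theorem farfield_R0B : B1 / R0B + B2 / R0B ^ 2 + pertB < 1 := by norm_num [B1, B2, R0B, pertB]
/-- Implementation 2's far-field radius is below implementation 1's (`11.41 ≤ 12.51`) and below the registered ceiling `20`. [folklore] -/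
theorem R0B_le_R0 : R0B ≤ R0 ∧ R0B ≤ 20 := by refine ⟨?_, ?_⟩ <;> norm_num [R0B, R0]
/-- The arc of record lies in implementation 2's far field: `R0B ≤ R₀c` and `B₁/R₀c + B₂/R₀c² + pert < 1`. [folklore] -/
theorem farfield_arcB : R0B ≤ R0c ∧ B1 / R0c + B2 / R0c ^ 2 + pertB < 1 := by
  refine ⟨by norm_num [R0B, R0c], by norm_num [B1, B2, R0c, pertB]⟩

/-! ### S2 — the contour, implementation 2 (literals of `s2_impl2.json` `94f123d366e47d6e`, kit j270205) -/
/-- Number of segment points (upper half) in implementation 2's chain: the 23 of record, no bisection insertion was needed. [folklore] -/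
def nSegmentPointsB : ℕ := 23
/-- `min_k |E(σ_k)|` over implementation 2's contour points (DOWN; `0.45301288` at `σ = −γ′`). [folklore] -/
def minAbsEB : ℚ := (4530 : ℚ) / 10000
/-- Smallest certified step radius of implementation 2 on the segment (DOWN; `0.28355` at `σ = −γ′`). [folklore] -/
def minStepRadiusB : ℚ := (2835 : ℚ) / 10000
/-- `E(−γ′)` upper endpoint in implementation 2 (real box `[−0.45301301, −0.45301289]`). [folklore] -/
def EstartHiB : ℚ := -(453012 : ℚ) / 1000000
/-- `E(R₀c)` lower endpoint in implementation 2 (real box `[0.8023369702, 0.8023369704]`). [folklore] -/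
def EendLoB : ℚ := (802336 : ℚ) / 1000000
/-- Winding ball endpoints for `E` (`Ω̄`) in implementation 2: `W ∈ [−1.000001, −0.999999]` (printed `[−1.00000096, −0.99999904]`). [folklore] -/
def WloBarB : ℚ := -(1000001 : ℚ) / 1000000
/-- see `WloBarB`. [folklore] -/
def WhiBarB : ℚ := -(999999 : ℚ) / 1000000
/-- Winding ball endpoints for `E*` (`Ω*`, Δ-inflated) in implementation 2: `W* ∈ [−1.0964, −0.9054]`. [folklore] -/
def WloStarB : ℚ := -(10964 : ℚ) / 10000
/-- see `WloStarB`. [folklore] -/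
def WhiStarB : ℚ := -(9054 : ℚ) / 10000

/-- The step-rule budget of implementation 2 is positive with room: `minAbsEB − 3·pertB > 0.44`. [folklore] -/
theorem step_budget_posB : (44 : ℚ) / 100 < minAbsEB - 3 * pertB := by norm_num [minAbsEB, pertB]
/-- Implementation 2's smallest certified radius covers the first (largest relative) gap of the chain: `firstGap < minStepRadiusB`. [folklore] -/
theorem firstGap_lt_radiusB : firstGap < minStepRadiusB := by norm_num [firstGap, minStepRadiusB]
/-- `E` is real and NEGATIVE at `σ = −γ′`, real and POSITIVE at `σ = R₀c` in implementation 2 (R7). [folklore] -/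
theorem E_signsB : EstartHiB < 0 ∧ 0 < EendLoB := by refine ⟨by norm_num [EstartHiB], by norm_num [EendLoB]⟩
/-- Implementation 2's winding ball of `E` contains `−1` and no other integer. [folklore] -/
theorem W_ball_barB : WloBarB ≤ (W : ℚ) ∧ (W : ℚ) ≤ WhiBarB ∧ WhiBarB - WloBarB < 1 := by
  refine ⟨?_, ?_, ?_⟩ <;> norm_num [WloBarB, WhiBarB, W]
/-- Implementation 2's winding ball of `E*` contains `−1` and no other integer. [folklore] -/
theorem W_ball_starB : WloStarB ≤ (W : ℚ) ∧ (W : ℚ) ≤ WhiStarB ∧ WhiStarB - WloStarB < 1 := by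
  refine ⟨?_, ?_, ?_⟩ <;> norm_num [WloStarB, WhiStarB, W]

/-! ### Agreement of the two implementations -/
/-- The two `Ω̄`-winding balls INTERSECT (implementation 2's lies inside implementation 1's) and the two `Ω*`-balls intersect: both implementations
certify the same integer `W = −1`, i.e. the same zero count `nZeros = 1`. [folklore] -/
theorem windings_agree :
    WloBar ≤ WloBarB ∧ WhiBarB ≤ WhiBar ∧ WloStar ≤ WloStarB ∧ WhiStarB ≤ WhiStar ∧ (nZeros : ℤ) = -W := by
  refine ⟨?_, ?_, ?_, ?_, ?_⟩ <;> norm_num [WloBar, WloBarB, WhiBar, WhiBarB, WloStar, WloStarB, WhiStar, WhiStarB, nZeros, W]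
/-- Both S1 certificates are positive and implementation 2's far field is the sharper one: the TWO-ARITHMETIC form of the Z3-SR-SPEC verdict inequalities. [folklore] -/
theorem two_arithmetics :
    0 < CertificateViscousSheetRSpectrum.lamCert ∧ 0 < lamCertB ∧ R0B ≤ R0 ∧
      B1 / R0B + B2 / R0B ^ 2 + pertB < 1 ∧ WloBarB ≤ (W : ℚ) ∧ (W : ℚ) ≤ WhiBarB := by
  refine ⟨CertificateViscousSheetRSpectrum.lamCert_pos, lamCertB_pos, R0B_le_R0.1, farfield_R0B, W_ball_barB.1, W_ball_barB.2.1⟩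

end CertificateViscousSheetRSpectrumB
end Summit.NavierStokesRegularity.OSWSelfSimilar
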